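import Literature.AlgebraicGeometry.Morphisms.CechModuleH2RefinementLemmas
import Literature.AlgebraicGeometry.Morphisms.CechModuleAffine
import HarnessLib

/-!
# The refinement map on `Ȟ²(𝒰, M)` and its injectivity for affine covers
# (Görtz–Wedhorn II Cor. 21.81 / Thm. 22.9 in degree `2`; Hartshorne III Lemma 4.4, Thm. 4.5)

Layer `Literature/AlgebraicGeometry/Morphisms`, namespace `Literature.AlgebraicGeometry.Morphisms`.  Sequel of
`CechModuleH2Refinement(Lemmas)` (the refinement map `ρ = cechMRefineC2` on the Čech `2`-cochains of a sheaf of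
`𝒪_X`-modules `M` on an `A`-scheme `f : X → Spec A`, for a map of families of opens `τ : 𝒱 → 𝒰`, `V_j ⊆ U_{τ j}`, a map
of complexes preserving `2`-cocycles and `2`-coboundaries) and of `CechModuleRefinement` (`mem_cechMB1_of_refineMC1_mem_cechMB1`:
the cocycle form of the INJECTIVITY of `Ȟ¹(𝒰, M) → Ȟ¹(𝒱, M)` when `𝒱` covers every `U_i`).  This file is the degree-`2`
companion, in the FULL ordered Čech complex of `Morphisms/CechModule(H2)`:

* **`mem_cechMB2_of_refineMC2_mem_cechMB2`** — the cocycle form of the injectivity of `Ȟ²(𝒰, M) → Ȟ²(𝒱, M)`: if `𝒱`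
  covers every `U_i`, if for every `i` every Čech `1`-cocycle of `M` on the family `(U_i ∩ V_j)_j` is a coboundary
  («`Ȟ¹(U_i, M) = 0` on that cover»), and if the refinement `ρ z` of a `2`-cocycle `z` of `M` on `𝒰` is a
  `2`-coboundary `d¹ c` on `𝒱`, then `z` is a `2`-coboundary on `𝒰`.  Proof (the degree-`2` step of the Cartan–Leray
  argument «a refinement by a cover acyclic on the members induces an injection on Čech cohomology», written with
  elements): on `U_i` the cone `hⁱ_{jl} := z_{i, τ j, τ l}|` has `d¹ hⁱ = (ρ z)| = (d¹ c)|` by the cocycle identity at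
  `(i, τ j, τ l, τ m)`, so `hⁱ − c| = d⁰ eⁱ` on `(U_i ∩ V_j)_j`; on `U_i ∩ U_{i'}` the sections
  `e^{i'}_j − eⁱ_j + z_{i i', τ j}|` on `U_i ∩ U_{i'} ∩ V_j` agree on overlaps (cocycle identity at `(i, i', τ j, τ l)`),
  hence glue to `γ_{i i'} ∈ Γ(U_i ∩ U_{i'}, M)`, and `d¹ γ = z` (checked on the `V_j`: cocycle identity at
  `(i, i', i'', τ j)`);
* `CechMH2.mk_eq_mk_of_refineMC2_sub_mem_cechMB2`, `CechMH2.mk_eq_zero_of_refineMC2_mem_cechMB2` — the same on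
  classes: two classes of `Ȟ²(𝒰, M)` whose refined cocycles are cohomologous on `𝒱` are equal (injectivity of
  `Ȟ²(𝒰, M) → Ȟ²(𝒱, M)`, stated without naming the map: this file is theorems-only; the packaged `A`-linear map
  `cechMRefineH2` is the definition-lane sequel `CechModuleH2RefinementMap`);
* `…_of_isAffineOpen` — in particular for `M` affine-localizing (e.g. quasi-coherent,
  ★ `Modules.IsAffineLocalizing.of_isQuasicoherent`), all `U_i` AFFINE and `𝒱` covering every `U_i` (the degree-`1`
  vanishing on the affine `U_i` is Görtz–Wedhorn II Lemma 22.1, ★ `cechMZ1_le_cechMB1_of_isAffineOpen`, which needs no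
  affineness of the `V_j`).

This is the injectivity half of «the Čech cohomology of a quasi-coherent sheaf on any affine open cover computes
`H²`» (Görtz–Wedhorn II Thm. 22.9; Hartshorne III Thm. 4.5) in degree `2`, Čech-internally; the tree's
`CechModuleH2CoverIndependence` has the same statement in VANISHING-transfer form only.  The surjectivity half
(which needs in addition the members `U_i ∩ V_j` and `U_i ∩ U_{i'}` affine) is deliberately not here.
Everything is proved; THEOREMS ONLY (no definition, no named fact, no instance).  Mathlib searched (pin v4.32):
`inf_iSup_eq` (used); Mathlib has no Čech cohomology of sheaves of modules on schemes
(cf. `CechModule.lean`).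

Cell `hodgecm-mathlib` (D-0151), F-11 α1 / J4-(iv) road (a′) brick (iv-3) (F0P1b-plan (g0) (R29); F0P1b-p04 (g0) census
`CENSUS-J4iv-Unobstructed.v0` §2): the injectivity of `Ȟ²(𝒰, 𝒪) → Ȟ²(𝒰 ∩ [n]⁻¹𝒰, 𝒪)` is what lets the `[n]^*`-eigenvalue
argument for the obstruction class run on the common refinement.  Generic and count-neutral; HC_CM is proved only modulo
the 7 printed citations until rung 0 closes — nothing here refers to it.

## References

* U. Görtz, T. Wedhorn, *Algebraic Geometry II: Cohomology of Schemes*, Springer Spektrum (2023),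
  doi:10.1007/978-3-658-43031-3: (21.16) Def. 21.71 and Lemma 21.72, p. 262; Cor. 21.81, p. 185; Lemma 22.1, p. 233;
  Thm. 22.9, p. 236. [GortzWedhorn2023]
* R. Hartshorne, *Algebraic Geometry*, GTM 52 (1977): III Lemma 4.4 (p. 221) and Thm. 4.5 (p. 222). [Hartshorne1977]
* The Stacks Project, Tag 09UY (refinements and Čech cohomology), Tag 01ED (Cohomology, Section 20.9: the Čech
  complex). [StacksProject]
-/

noncomputable section

open CategoryTheory AlgebraicGeometry Limits TopologicalSpace Opposite

universe u v w

namespace Literature.AlgebraicGeometry.Morphisms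

variable {A : Type u} [CommRing A] {X : Scheme.{u}} (f : X ⟶ Spec (.of A)) (M : X.Modules)

section Refine

variable {ι : Type v} {ι' : Type w} (U : ι → X.Opens) (V : ι' → X.Opens) (τ : ι' → ι)
  (hτ : ∀ j, V j ≤ U (τ j))

/-! ## Injectivity of `Ȟ²` under refinement -/

/-- **Cocycle form of the injectivity of `Ȟ²(𝒰, M) → Ȟ²(𝒱, M)`** (degree-`2` companion of
`mem_cechMB1_of_refineMC1_mem_cechMB1`): let `𝒱` cover every `U_i` and suppose that for every `i` every Čech
`1`-cocycle of `M` on `(U_i ∩ V_j)_j` is a coboundary.  If `z` is a `2`-cocycle of `M` on `𝒰` whose refinement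
`ρ z` is a `2`-coboundary on `𝒱`, then `z` is a `2`-coboundary on `𝒰`.  (Cone `hⁱ_{jl} = z_{i,τj,τl}|` on `U_i`,
`hⁱ − c| = d⁰eⁱ`; glue `γ_{ii'}| = e^{i'}_j − eⁱ_j + z_{ii',τj}|`; `d¹γ = z`.)
[cite: GortzWedhorn2023, Cor. 21.81 (p. 185) and Thm. 22.9 (p. 236), degree 2] -/
theorem mem_cechMB2_of_refineMC2_mem_cechMB2 (hU : ∀ i, U i ≤ ⨆ j, V j)
    (h1 : ∀ i, cechMZ1 f M (fun j => U i ⊓ V j) ≤ cechMB1 f M (fun j => U i ⊓ V j))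
    {z : CechMC2 f M U} (hz : z ∈ cechMZ2 f M U)
    (hρ : cechMRefineC2 f M U V τ hτ z ∈ cechMB2 f M V) :
    z ∈ cechMB2 f M U := by
  obtain ⟨c, hc⟩ := (mem_cechMB2_iff f M V _).mp hρ
  -- `hc' j l m`: the coboundary identity `c_{lm} - c_{jm} + c_{jl} = z_{τj τl τm}` on `V_j ∩ V_l ∩ V_m`
  have hc' : ∀ j l m,
      MSections.res f M (le_inf (inf_le_left.trans inf_le_right) inf_le_right) (c l m) -
          MSections.res f M (le_inf (inf_le_left.trans inf_le_left) inf_le_right) (c j m) +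
            MSections.res f M inf_le_left (c j l) =
        MSections.res f M (inf_le_inf (inf_le_inf (hτ j) (hτ l)) (hτ m)) (z (τ j) (τ l) (τ m)) := by
    intro j l m
    rw [← cechMD1_apply, hc, cechMRefineC2_apply]
  /- Step 1: the cone `hⁱ_{jl} = z_{i, τ j, τ l}|` on the family `(U_i ∩ V_j)_j`, minus `c|`, is a
  `1`-cocycle. -/
  set h : ∀ i, CechMC1 f M (fun j => U i ⊓ V j) := fun i j l =>
    MSections.res f M
      (le_inf (le_inf (inf_le_left.trans inf_le_left) ((inf_le_left.trans inf_le_right).trans (hτ j)))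
        ((inf_le_right.trans inf_le_right).trans (hτ l)))
      (z i (τ j) (τ l)) -
    MSections.res f M (inf_le_inf inf_le_right inf_le_right) (c j l) with hh
  have hhZ : ∀ i, h i ∈ cechMZ1 f M (fun j => U i ⊓ V j) := by
    intro i
    rw [mem_cechMZ1_iff]
    funext j l m
    rw [cechMD1_apply, Pi.zero_apply, Pi.zero_apply, Pi.zero_apply]
    simp only [hh, map_sub, MSections.res_res]
    -- the open `O = (U_i ∩ V_j) ∩ (U_i ∩ V_l) ∩ (U_i ∩ V_m)`
    have hOi : (U i ⊓ V j) ⊓ (U i ⊓ V l) ⊓ (U i ⊓ V m) ≤ U i := (inf_le_left.trans inf_le_left).trans inf_le_left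
    have hOj : (U i ⊓ V j) ⊓ (U i ⊓ V l) ⊓ (U i ⊓ V m) ≤ V j := (inf_le_left.trans inf_le_left).trans inf_le_right
    have hOl : (U i ⊓ V j) ⊓ (U i ⊓ V l) ⊓ (U i ⊓ V m) ≤ V l := (inf_le_left.trans inf_le_right).trans inf_le_right
    have hOm : (U i ⊓ V j) ⊓ (U i ⊓ V l) ⊓ (U i ⊓ V m) ≤ V m := inf_le_right.trans inf_le_right
    have hcoc := cechMZ2.cocycle_res f M U hz i (τ j) (τ l) (τ m) hOi (hOj.trans (hτ j)) (hOl.trans (hτ l))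
      (hOm.trans (hτ m))
    have hcb := congrArg (MSections.res f M (le_inf (le_inf hOj hOl) hOm : _ ≤ V j ⊓ V l ⊓ V m)) (hc' j l m)
    rw [map_add, map_sub, MSections.res_res, MSections.res_res, MSections.res_res, MSections.res_res] at hcb
    have key : ∀ (Zjlm Zilm Zijm Zijl Clm Cjm Cjl : MSections f M ((U i ⊓ V j) ⊓ (U i ⊓ V l) ⊓ (U i ⊓ V m))),
        Zjlm - Zilm + Zijm - Zijl = 0 → Clm - Cjm + Cjl = Zjlm →
          Zilm - Clm - (Zijm - Cjm) + (Zijl - Cjl) = 0 := by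
      intro Zjlm Zilm Zijm Zijl Clm Cjm Cjl h0 h1
      have : Zilm - Clm - (Zijm - Cjm) + (Zijl - Cjl) = -(Zjlm - Zilm + Zijm - Zijl) + (Zjlm - (Clm - Cjm + Cjl)) := by
        abel
      rw [this, h0, h1, neg_zero, sub_self, add_zero]
    exact key _ _ _ _ _ _ _ hcoc hcb
  /- Step 2: `hⁱ = d⁰ eⁱ` on `(U_i ∩ V_j)_j` (the `Ȟ¹`-vanishing hypothesis). -/
  have heex : ∀ i, ∃ e : CechMC0 f M (fun j => U i ⊓ V j), cechMD0 f M (fun j => U i ⊓ V j) e = h i :=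
    fun i => (mem_cechMB1_iff f M _ _).mp (h1 i (hhZ i))
  choose e he using heex
  -- `he' i j l`: `eⁱ_l - eⁱ_j = hⁱ_{jl} = z_{i,τj,τl}| - c_{jl}|` on `(U_i ∩ V_j) ∩ (U_i ∩ V_l)`
  have he' : ∀ i j l, cechMD0 f M (fun j => U i ⊓ V j) (e i) j l = h i j l := fun i j l => by
    rw [he i]
  /- Step 3: the sections `gⁱⁱ'_j = e^{i'}_j - eⁱ_j + z_{i i' τj}|` on `U_i ∩ U_{i'} ∩ V_j` agree on overlaps. -/
  set g : ∀ i i', CechMC0 f M (fun j => U i ⊓ U i' ⊓ V j) := fun i i' j =>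
    MSections.res f M (inf_le_inf inf_le_right le_rfl : U i ⊓ U i' ⊓ V j ≤ U i' ⊓ V j) (e i' j) -
      MSections.res f M (inf_le_inf inf_le_left le_rfl : U i ⊓ U i' ⊓ V j ≤ U i ⊓ V j) (e i j) +
        MSections.res f M (inf_le_inf le_rfl (hτ j) : U i ⊓ U i' ⊓ V j ≤ U i ⊓ U i' ⊓ U (τ j)) (z i i' (τ j))
    with hg
  have hgZ : ∀ i i', cechMD0 f M (fun j => U i ⊓ U i' ⊓ V j) (g i i') = 0 := by
    intro i i'
    funext j l
    rw [cechMD0_apply, Pi.zero_apply, Pi.zero_apply]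
    simp only [hg, map_sub, map_add, MSections.res_res]
    -- the open `O = (U_i ∩ U_{i'} ∩ V_j) ∩ (U_i ∩ U_{i'} ∩ V_l)`
    have hOi : (U i ⊓ U i' ⊓ V j) ⊓ (U i ⊓ U i' ⊓ V l) ≤ U i := (inf_le_left.trans inf_le_left).trans inf_le_left
    have hOi' : (U i ⊓ U i' ⊓ V j) ⊓ (U i ⊓ U i' ⊓ V l) ≤ U i' := (inf_le_left.trans inf_le_left).trans inf_le_right
    have hOj : (U i ⊓ U i' ⊓ V j) ⊓ (U i ⊓ U i' ⊓ V l) ≤ V j := inf_le_left.trans inf_le_right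
    have hOl : (U i ⊓ U i' ⊓ V j) ⊓ (U i ⊓ U i' ⊓ V l) ≤ V l := inf_le_right.trans inf_le_right
    have hcoc := cechMZ2.cocycle_res f M U hz i i' (τ j) (τ l) hOi hOi' (hOj.trans (hτ j)) (hOl.trans (hτ l))
    have hei0 := he' i j l
    have hei'0 := he' i' j l
    rw [cechMD0_apply] at hei0 hei'0
    simp only [hh] at hei0 hei'0
    have hei := congrArg (MSections.res f M (le_inf (le_inf hOi hOj) (le_inf hOi hOl) :
      _ ≤ (U i ⊓ V j) ⊓ (U i ⊓ V l))) hei0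
    have hei' := congrArg (MSections.res f M (le_inf (le_inf hOi' hOj) (le_inf hOi' hOl) :
      _ ≤ (U i' ⊓ V j) ⊓ (U i' ⊓ V l))) hei'0
    rw [map_sub, map_sub, MSections.res_res, MSections.res_res, MSections.res_res, MSections.res_res] at hei hei'
    have key : ∀ (Ei'l Eil Zii'l Ei'j Eij Zii'j Zi'jl Zijl Cjl :
        MSections f M ((U i ⊓ U i' ⊓ V j) ⊓ (U i ⊓ U i' ⊓ V l))),
        Zi'jl - Zijl + Zii'l - Zii'j = 0 → Eil - Eij = Zijl - Cjl → Ei'l - Ei'j = Zi'jl - Cjl →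
          Ei'l - Eil + Zii'l - (Ei'j - Eij + Zii'j) = 0 := by
      intro Ei'l Eil Zii'l Ei'j Eij Zii'j Zi'jl Zijl Cjl h0 h2 h3
      have : Ei'l - Eil + Zii'l - (Ei'j - Eij + Zii'j) =
          (Ei'l - Ei'j) - (Eil - Eij) + Zii'l - Zii'j := by abel
      rw [this, h2, h3]
      have : Zi'jl - Cjl - (Zijl - Cjl) + Zii'l - Zii'j = Zi'jl - Zijl + Zii'l - Zii'j := by abel
      rw [this, h0]
    exact key _ _ _ _ _ _ _ _ _ hcoc hei hei'
  /- Step 4: glue to `γ_{ii'} ∈ Γ(U_i ∩ U_{i'}, M)`. -/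
  have hγex : ∀ i i', ∃ t : MSections f M (U i ⊓ U i'),
      ∀ j, MSections.res f M (inf_le_left : U i ⊓ U i' ⊓ V j ≤ U i ⊓ U i') t = g i i' j := by
    intro i i'
    refine exists_res_eq_of_cechMD0_eq_zero f M (fun j => U i ⊓ U i' ⊓ V j) (fun j => inf_le_left) ?_ (hgZ i i')
    rw [← inf_iSup_eq]
    exact le_inf le_rfl (inf_le_left.trans (hU i))
  choose γ hγ using hγex
  /- Step 5: `d¹ γ = z`, checked locally on the `V_j`. -/
  refine (mem_cechMB2_iff f M U z).mpr ⟨γ, ?_⟩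
  funext i i' i''
  apply eq_of_forall_res_eq f M (fun j => U i ⊓ U i' ⊓ U i'' ⊓ V j) (fun j => inf_le_left)
  · rw [← inf_iSup_eq]
    exact le_inf le_rfl ((inf_le_left.trans inf_le_left).trans (hU i))
  intro j
  -- the open `O = U_i ∩ U_{i'} ∩ U_{i''} ∩ V_j`
  have hOi : U i ⊓ U i' ⊓ U i'' ⊓ V j ≤ U i := (inf_le_left.trans inf_le_left).trans inf_le_left
  have hOi' : U i ⊓ U i' ⊓ U i'' ⊓ V j ≤ U i' := (inf_le_left.trans inf_le_left).trans inf_le_right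
  have hOi'' : U i ⊓ U i' ⊓ U i'' ⊓ V j ≤ U i'' := inf_le_left.trans inf_le_right
  have hOj : U i ⊓ U i' ⊓ U i'' ⊓ V j ≤ V j := inf_le_right
  have hg1 := congrArg (MSections.res f M (le_inf (le_inf hOi' hOi'') hOj : _ ≤ U i' ⊓ U i'' ⊓ V j)) (hγ i' i'' j)
  have hg2 := congrArg (MSections.res f M (le_inf (le_inf hOi hOi'') hOj : _ ≤ U i ⊓ U i'' ⊓ V j)) (hγ i i'' j)
  have hg3 := congrArg (MSections.res f M (le_inf (le_inf hOi hOi') hOj : _ ≤ U i ⊓ U i' ⊓ V j)) (hγ i i' j)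
  simp only [hg, map_sub, map_add, MSections.res_res] at hg1 hg2 hg3
  rw [cechMD1_apply, map_add, map_sub, MSections.res_res, MSections.res_res, MSections.res_res]
  erw [hg1, hg2, hg3]
  have hcoc := cechMZ2.cocycle_res f M U hz i i' i'' (τ j) hOi hOi' hOi'' (hOj.trans (hτ j))
  have key : ∀ (Ei'' Ei' Ei Zi'i''j Zii''j Zii'j Zii'i'' : MSections f M (U i ⊓ U i' ⊓ U i'' ⊓ V j)),
      Zi'i''j - Zii''j + Zii'j - Zii'i'' = 0 →
        Ei'' - Ei' + Zi'i''j - (Ei'' - Ei + Zii''j) + (Ei' - Ei + Zii'j) = Zii'i'' := by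
    intro Ei'' Ei' Ei Zi'i''j Zii''j Zii'j Zii'i'' h0
    have : Ei'' - Ei' + Zi'i''j - (Ei'' - Ei + Zii''j) + (Ei' - Ei + Zii'j) =
        (Zi'i''j - Zii''j + Zii'j - Zii'i'') + Zii'i'' := by abel
    rw [this, h0, zero_add]
  exact key _ _ _ _ _ _ _ hcoc

/-- **Injectivity of `Ȟ²(𝒰, M) → Ȟ²(𝒱, M)` on classes**: if `𝒱` covers every `U_i`, every Čech `1`-cocycle of `M`
on each family `(U_i ∩ V_j)_j` is a coboundary, and the refinements of two `2`-cocycles `z, z'` of `M` on `𝒰` are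
cohomologous on `𝒱`, then `[z] = [z']` in `Ȟ²(𝒰, M)`.
[cite: GortzWedhorn2023, Cor. 21.81 (p. 185) and Thm. 22.9 (p. 236), degree 2] -/
theorem CechMH2.mk_eq_mk_of_refineMC2_sub_mem_cechMB2 (hU : ∀ i, U i ≤ ⨆ j, V j)
    (h1 : ∀ i, cechMZ1 f M (fun j => U i ⊓ V j) ≤ cechMB1 f M (fun j => U i ⊓ V j))
    (z z' : cechMZ2 f M U)
    (h : cechMRefineC2 f M U V τ hτ z - cechMRefineC2 f M U V τ hτ z' ∈ cechMB2 f M V) :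
    CechMH2.mk f M U z = CechMH2.mk f M U z' := by
  rw [CechMH2.mk_eq_mk_iff]
  refine mem_cechMB2_of_refineMC2_mem_cechMB2 f M U V τ hτ hU h1 (Submodule.sub_mem _ z.2 z'.2) ?_
  rw [map_sub]
  exact h

/-- A class of `Ȟ²(𝒰, M)` whose refined cocycle is a `2`-coboundary on `𝒱` is zero (same hypotheses).
[cite: GortzWedhorn2023, Cor. 21.81 (p. 185) and Thm. 22.9 (p. 236), degree 2] -/
theorem CechMH2.mk_eq_zero_of_refineMC2_mem_cechMB2 (hU : ∀ i, U i ≤ ⨆ j, V j)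
    (h1 : ∀ i, cechMZ1 f M (fun j => U i ⊓ V j) ≤ cechMB1 f M (fun j => U i ⊓ V j))
    (z : cechMZ2 f M U) (h : cechMRefineC2 f M U V τ hτ z ∈ cechMB2 f M V) :
    CechMH2.mk f M U z = 0 := by
  rw [CechMH2.mk_eq_zero_iff]
  exact mem_cechMB2_of_refineMC2_mem_cechMB2 f M U V τ hτ hU h1 z.2 h

/-! ## The affine case -/

/-- The degree-`1` vanishing hypothesis holds for a family of AFFINE opens `𝒰` and an affine-localizing (e.g.
quasi-coherent) `M`, for every family `𝒱` covering every `U_i`: Görtz–Wedhorn II Lemma 22.1 on the affine `U_i`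
for the covering family `(U_i ∩ V_j)_j` (any opens `V_j`). [cite: GortzWedhorn2023, Lemma 22.1 (p. 233)] -/
theorem cechMZ1_inf_le_cechMB1_inf_of_isAffineOpen
    (hM : Literature.AlgebraicGeometry.Modules.IsAffineLocalizing M) (hUaff : ∀ i, IsAffineOpen (U i))
    (hU : ∀ i, U i ≤ ⨆ j, V j) (i : ι) :
    cechMZ1 f M (fun j => U i ⊓ V j) ≤ cechMB1 f M (fun j => U i ⊓ V j) := by
  refine cechMZ1_le_cechMB1_of_isAffineOpen f hM (hUaff i) (fun j => U i ⊓ V j) ?_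
  rw [← inf_iSup_eq]
  exact le_antisymm inf_le_left (le_inf le_rfl (hU i))

/-- **Cocycle form of the injectivity of `Ȟ²(𝒰, M) → Ȟ²(𝒱, M)` for a family of AFFINE opens `𝒰` and an
affine-localizing (e.g. quasi-coherent) `M`**, for every refinement `𝒱` covering every `U_i`: a `2`-cocycle of `M`
on `𝒰` whose refinement to `𝒱` is a `2`-coboundary is itself a `2`-coboundary.
[cite: GortzWedhorn2023, Lemma 22.1 (p. 233), Cor. 21.81 (p. 185), Thm. 22.9 (p. 236)]
[cite: Hartshorne1977, III Lemma 4.4 (p. 221) and Thm. 4.5 (p. 222)] -/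
theorem mem_cechMB2_of_refineMC2_mem_cechMB2_of_isAffineOpen
    (hM : Literature.AlgebraicGeometry.Modules.IsAffineLocalizing M) (hUaff : ∀ i, IsAffineOpen (U i))
    (hU : ∀ i, U i ≤ ⨆ j, V j) {z : CechMC2 f M U} (hz : z ∈ cechMZ2 f M U)
    (hρ : cechMRefineC2 f M U V τ hτ z ∈ cechMB2 f M V) :
    z ∈ cechMB2 f M U :=
  mem_cechMB2_of_refineMC2_mem_cechMB2 f M U V τ hτ hU
    (cechMZ1_inf_le_cechMB1_inf_of_isAffineOpen f M U V hM hUaff hU) hz hρ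

/-- Class form of the affine case: two classes of `Ȟ²(𝒰, M)` (`𝒰` affine, `M` affine-localizing) whose refined
cocycles are cohomologous on a refinement `𝒱` covering every `U_i` are equal.
[cite: GortzWedhorn2023, Lemma 22.1 (p. 233) and Thm. 22.9 (p. 236)] [cite: Hartshorne1977, III Thm. 4.5 (p. 222)] -/
theorem CechMH2.mk_eq_mk_of_refineMC2_sub_mem_cechMB2_of_isAffineOpen
    (hM : Literature.AlgebraicGeometry.Modules.IsAffineLocalizing M) (hUaff : ∀ i, IsAffineOpen (U i))
    (hU : ∀ i, U i ≤ ⨆ j, V j) (z z' : cechMZ2 f M U)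
    (h : cechMRefineC2 f M U V τ hτ z - cechMRefineC2 f M U V τ hτ z' ∈ cechMB2 f M V) :
    CechMH2.mk f M U z = CechMH2.mk f M U z' :=
  CechMH2.mk_eq_mk_of_refineMC2_sub_mem_cechMB2 f M U V τ hτ hU
    (cechMZ1_inf_le_cechMB1_inf_of_isAffineOpen f M U V hM hUaff hU) z z' h

/-- Class form of the affine case: a class of `Ȟ²(𝒰, M)` (`𝒰` affine, `M` affine-localizing) whose refined cocycle is a
`2`-coboundary on a refinement `𝒱` covering every `U_i` is zero.
[cite: GortzWedhorn2023, Lemma 22.1 (p. 233) and Thm. 22.9 (p. 236)] [cite: Hartshorne1977, III Thm. 4.5 (p. 222)] -/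
theorem CechMH2.mk_eq_zero_of_refineMC2_mem_cechMB2_of_isAffineOpen
    (hM : Literature.AlgebraicGeometry.Modules.IsAffineLocalizing M) (hUaff : ∀ i, IsAffineOpen (U i))
    (hU : ∀ i, U i ≤ ⨆ j, V j) (z : cechMZ2 f M U) (h : cechMRefineC2 f M U V τ hτ z ∈ cechMB2 f M V) :
    CechMH2.mk f M U z = 0 :=
  CechMH2.mk_eq_zero_of_refineMC2_mem_cechMB2 f M U V τ hτ hU
    (cechMZ1_inf_le_cechMB1_inf_of_isAffineOpen f M U V hM hUaff hU) z h

end Refine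

end Literature.AlgebraicGeometry.Morphisms

end
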